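import Summits.ResolutionOfSingularities.ResolutionOfSingularities.Theorems.EquisingularLiftEquisingularLiftNatNoseTowerSevenDefs
import HarnessLib

/-!
# T23-A «TOWER WITH A BOUNDARY LIST» (planner memo CRUX-PLAN v3.33 §II5; desk res-L1-w45b-plan-1 g19 ruling (R1) 03:22Z; engine word res-L1-w45b-stub-4 g10
# `T23A-ENGINE-WORD.md` 340f00d84dbcbbfc): `PtTransportOK` / `RoundTransportOK` / `TowerPtRegB` / `TowerPtRamB` / `TowerRoundB` / `ReachTowerB` / `ReachNoseTowerB`,
# monotonicity `reachTowerB_of_reachTower₆` / `reachNoseTowerB_of_reachNoseTower₇` — Defs of the TWENTY-SIXTH registration (text owner res-L1-w45b-lead-2 g4)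

OURS · L1 W4.5(b) · EL♮(3) stmt-ResolutionOfSingularities-20148 · counted 0 · AI-written planning vocabulary, weaker than expert review; nothing of [Hironaka2017]
asserted. DESIGN (minimal churn): the stage predicate keeps the ₂/₅ shape `R G γ T E K` and gains ONE extra component `Es : List (Set G)` = the RETAINED older
exceptional surfaces (`R G γ T E Es K`; seed `[]`). The running surface `E` and the cone shadow `K` behave EXACTLY as in `TowerPtReg₂` / `TowerPtRam₂` /
`TowerRound₅` when the round is hosted by `E`. New: (1) at every step the producer RETAINS any sub-family of admissible transports of the members of `E :: Es`
(point steps: RULING-6 condition «member finite over the carrier stage or not through the point»; rounds: HOST-RELATIVE «the member is the host, or the centre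
is disjoint from it» — a non-host member meeting the centre is lost at tier 1; transversal transport = refinement T23-A′, boundary-witnessed double-curve rounds =
T23-A″); (2) a ROUND may be HOSTED by ANY retained member `Hst ∈ Es` on the genus-free Čech clause of `TowerRound₅` with `E := Hst` (`IsIrreducible Z ∧ Z̃ regular ∧
regG ∧ regH̃st ∧ DirStepUnobs G Hst _ Z hZ`); the new running surface is then `υ₂⁻¹ Z` and the cone shadow is dropped or transported away from `Z`.
Upstairs (engine, owner res-L1-w45b-stub-4 g10): one O-flat regular model `Tower.Exc₃ … F hF ∅ …` per RETAINED member inside the same stage datum (shadow forgotten),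
the (T-k) round case member-agnostic, brick B-AWAY for disjoint transport, explicit-stage re-cuts of the ₆ step bricks. `reachTowerB_of_reachTower₆` /
`reachNoseTowerB_of_reachNoseTower₇` (retain nothing) are proved here but not needed by the composition (old rungs stand; residues gain one ¬hypothesis each).
-/

set_option linter.dupNamespace false

noncomputable section

open CategoryTheory AlgebraicGeometry TopologicalSpace
open Literature.AlgebraicGeometry.Resolution
open AlgebraicGeometry.Scheme.IdealSheafData

namespace Summit.ResolutionOfSingularities.ResolutionOfSingularities.Cruxes.EquisingularLiftNat.Sections

/-- Admissible transport of a retained exceptional surface `F` through a POINT step at `y` (RULING-6 condition) — the retained list after the step consists of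
such transports only (any sub-family; dropping is always allowed). [OURS · draft] -/
def PtTransportOK {F₉ F₁₀ G G' : Scheme.{0}} (υ' : F₁₀ ⟶ F₉) (γ : G ⟶ F₁₀) (υ₂ : G' ⟶ G) (y : G) (F : Set G) (F' : Set G') : Prop :=
  (((γ ≫ υ') '' F).Finite ∨ y ∉ F) ∧ F' = closure (υ₂ ⁻¹' (F \ {y}))

/-- Admissible transport of a retained exceptional surface `F` through a ROUND with centre `Z` hosted by the surface `Hst` (engine word res-L1-w45b-stub-4
g10, T23A-ENGINE-WORD.md 340f00d84dbcbbfc): `F` IS the host (strict transform ≅ `F`, the upstairs centre is Cartier in the host's model) or `Z` is DISJOINT from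
`F` (iso-transport away from the centre, brick B-AWAY); a non-host member containing or meeting `Z` is not transportable at tier 1 (double curves: one of the
two surfaces is lost; transversal transport = T23-A′). [OURS · draft] -/
def RoundTransportOK {G G' : Scheme.{0}} (υ₂ : G' ⟶ G) (Z Hst F : Set G) (F' : Set G') : Prop :=
  (F = Hst ∨ Disjoint Z F) ∧ F' = closure (υ₂ ⁻¹' (F \ Z))

/-- **TOWER-B / (pt-reg)** — `TowerPtReg₂` verbatim on `(T, E, K)`, plus the retained list: every member of `Es'` is an admissible point-transport of a member of
`E :: Es`. [OURS · draft] -/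
def TowerPtRegB (F₉ F₁₀ : Scheme.{0}) (υ' : F₁₀ ⟶ F₉)
    (R : ∀ G : Scheme.{0}, (G ⟶ F₁₀) → Set G → Set G → List (Set G) → Set G → Prop) : Prop :=
  ∀ (G G' : Scheme.{0}) (γ : G ⟶ F₁₀) (T E : Set G) (Es : List (Set G)) (K : Set G) (y : redSub G (closure T) isClosed_closure)
      (υ₂ : G' ⟶ G) (hy : IsClosed ({curvePt G T y} : Set G)) (K' : Set G') (E' : Set G') (Es' : List (Set G')),
    R G γ T E Es K →
    ¬ IsRegularLocalRing ((redSub G (closure T) isClosed_closure).presheaf.stalk y) →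
    IsRegularLocalRing (G.presheaf.stalk (curvePt G T y)) →
    IsBlowup υ₂ (Scheme.IdealSheafData.vanishingIdeal (⟨{curvePt G T y}, hy⟩ : Closeds G)) →
    (K' = ∅ ∨ (curvePt G T y ∉ closure K ∧ K' = closure (υ₂ ⁻¹' (K \ {curvePt G T y})))) →
    (E' = υ₂ ⁻¹' {curvePt G T y} ∨
      ((((γ ≫ υ') '' E).Finite ∨ curvePt G T y ∉ E) ∧ E' = closure (υ₂ ⁻¹' (E \ {curvePt G T y})))) →
    (∀ F' ∈ Es', ∃ F ∈ E :: Es, PtTransportOK υ' γ υ₂ (curvePt G T y) F F') →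
    R G' (υ₂ ≫ γ) (closure (υ₂ ⁻¹' (T \ {curvePt G T y}))) E' Es' K'

/-- **TOWER-B / (pt-ram)** — `TowerPtRam₂` verbatim on `(T, E, K)`, plus the retained list as in `TowerPtRegB`. [OURS · draft] -/
def TowerPtRamB (F₉ F₁₀ : Scheme.{0}) (υ' : F₁₀ ⟶ F₉)
    (R : ∀ G : Scheme.{0}, (G ⟶ F₁₀) → Set G → Set G → List (Set G) → Set G → Prop) : Prop :=
  ∀ (G G' : Scheme.{0}) (γ : G ⟶ F₁₀) (T E : Set G) (Es : List (Set G)) (K : Set G) (y : redSub G (closure T) isClosed_closure)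
      (J : G.IdealSheafData) (υ₂ : G' ⟶ G) (K' : Set G') (E' : Set G') (Es' : List (Set G')),
    R G γ T E Es K →
    ¬ IsRegularLocalRing ((redSub G (closure T) isClosed_closure).presheaf.stalk y) →
    ¬ IsRegularLocalRing (G.presheaf.stalk (curvePt G T y)) →
    (J.support : Set G) = {curvePt G T y} →
    (∃ (ℓ : Fin 3 → G.presheaf.stalk (curvePt G T y)) (hℓ : ∀ i, ℓ i ∈ IsLocalRing.maximalIdeal (G.presheaf.stalk (curvePt G T y))),
      stalkIdeal J (curvePt G T y) = Ideal.span (Set.range ℓ) ∧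
      LinearIndependent (IsLocalRing.ResidueField (G.presheaf.stalk (curvePt G T y)))
        (fun i => (IsLocalRing.maximalIdeal (G.presheaf.stalk (curvePt G T y))).toCotangent ⟨ℓ i, hℓ i⟩)) →
    IsBlowup υ₂ J →
    (K' = ∅ ∨ (curvePt G T y ∉ closure K ∧ K' = closure (υ₂ ⁻¹' (K \ {curvePt G T y})))) →
    (E' = υ₂ ⁻¹' {curvePt G T y} ∨
      ((((γ ≫ υ') '' E).Finite ∨ curvePt G T y ∉ E) ∧ E' = closure (υ₂ ⁻¹' (E \ {curvePt G T y})))) →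
    (∀ F' ∈ Es', ∃ F ∈ E :: Es, PtTransportOK υ' γ υ₂ (curvePt G T y) F F') →
    R G' (υ₂ ≫ γ) (closure (υ₂ ⁻¹' (T \ {curvePt G T y}))) E' Es' K'

/-- **TOWER-B / (round)** — a round blows up a closed `Z ⊆ T` HOSTED either by the running surface `E` (`Hst = E`) under the `TowerRound₅` admission and
cone-shadow clause VERBATIM (then `E' = υ₂⁻¹Z` or `closure υ₂⁻¹(E ∖ Z)`, as in ₅) or by a RETAINED member `Hst ∈ Es` under the genus-free Čech clause of ₅ with
`E := Hst` (then `E' = υ₂⁻¹Z`, and the cone shadow is dropped or transported only when `Z` misses `closure K` — no (k-iii)/(k-v)/(k-vi) coupling to a surface born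
inside another member); in both cases the new retained list consists of host-relative admissible round-transports of members of `E :: Es` (engine word stub-4 g10:
(a) host-relative transport, (b) no per-member T-DIM shadow, (c) `List`). [OURS · draft → Defs of the TWENTY-SIXTH registration] -/
def TowerRoundB (F₉ F₁₀ : Scheme.{0}) (υ' : F₁₀ ⟶ F₉) (Z₉ : Set F₉) (hZ₉ : IsClosed Z₉)
    (R : ∀ G : Scheme.{0}, (G ⟶ F₁₀) → Set G → Set G → List (Set G) → Set G → Prop) : Prop :=
  ∀ (G G' : Scheme.{0}) (γ : G ⟶ F₁₀) (T E : Set G) (Es : List (Set G)) (K : Set G) (hE : IsClosed E) (Z : Set G) (hZ : IsClosed Z)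
      (Hst : Set G) (υ₂ : G' ⟶ G) (K' : Set G') (E' : Set G') (Es' : List (Set G')),
    R G γ T E Es K →
    Z ⊆ T → Z.Nonempty →
    TowerFull F₉ F₁₀ υ' Z₉ hZ₉ G γ Z hZ →
    ((Hst = E ∧ Z ⊆ E ∧
        ((DirStepSec F₉ F₁₀ υ' Z₉ hZ₉ G γ Z hZ ∧
            ((RationalCarrier (redSub F₉ Z₉ hZ₉) ∧
                (∀ x : redSub G Z hZ, IsRegularLocalRing (G.presheaf.stalk (redSubι G Z hZ x))) ∧
                (∀ (i : redSub G Z hZ ⟶ redSub G E hE), i ≫ redSubι G E hE = redSubι G Z hZ →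
                  ∀ x : redSub G Z hZ, IsRegularLocalRing ((redSub G E hE).presheaf.stalk (i x))) ∧
                DirStepUnobs G E hE Z hZ) ∨
              ConeWitness G E hE K Z hZ)) ∨
          (IsIrreducible Z ∧ (∀ x : redSub G Z hZ, IsRegularLocalRing ((redSub G Z hZ).presheaf.stalk x)) ∧
            (∀ x : redSub G Z hZ, IsRegularLocalRing (G.presheaf.stalk (redSubι G Z hZ x))) ∧
            (∀ (i : redSub G Z hZ ⟶ redSub G E hE), i ≫ redSubι G E hE = redSubι G Z hZ →
              ∀ x : redSub G Z hZ, IsRegularLocalRing ((redSub G E hE).presheaf.stalk (i x))) ∧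
            DirStepUnobs G E hE Z hZ)) ∧
        (E' = υ₂ ⁻¹' Z ∨ E' = closure (υ₂ ⁻¹' (E \ Z))) ∧
        (K' = ∅ ∨ ((ConeWitness G E hE K Z hZ ∨ closure (Z \ closure K) = Z) ∧ K' = closure (υ₂ ⁻¹' (K \ Z))))) ∨
      (Hst ∈ Es ∧ ∃ hF : IsClosed Hst, Z ⊆ Hst ∧ IsIrreducible Z ∧
        (∀ x : redSub G Z hZ, IsRegularLocalRing ((redSub G Z hZ).presheaf.stalk x)) ∧
        (∀ x : redSub G Z hZ, IsRegularLocalRing (G.presheaf.stalk (redSubι G Z hZ x))) ∧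
        (∀ (i : redSub G Z hZ ⟶ redSub G Hst hF), i ≫ redSubι G Hst hF = redSubι G Z hZ →
          ∀ x : redSub G Z hZ, IsRegularLocalRing ((redSub G Hst hF).presheaf.stalk (i x))) ∧
        DirStepUnobs G Hst hF Z hZ ∧
        E' = υ₂ ⁻¹' Z ∧
        (K' = ∅ ∨ (Disjoint Z (closure K) ∧ K' = closure (υ₂ ⁻¹' (K \ Z)))))) →
    IsBlowup υ₂ (Scheme.IdealSheafData.vanishingIdeal (⟨Z, hZ⟩ : Closeds G)) →
    (∀ F' ∈ Es', ∃ F ∈ E :: Es, RoundTransportOK υ₂ Z Hst F F') →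
    R G' (υ₂ ≫ γ) (closure (υ₂ ⁻¹' (T \ Z))) E' Es' K'

/-- **ReachTowerB** — `ReachTower₆` with the list component: same prefix (point step at `x`, locally principal `W`, in-carrier point closure, carrier `Z₉`),
seed `(F₁₀, 𝟙, St T₉, υ'⁻¹Z₉, [], St K₉)`, closure under `TowerPtRegB` / `TowerPtRamB` / `TowerRoundB`. Downstairs only. [OURS · draft] -/
def ReachTowerB (F₁ F₂ : Scheme.{0}) (υ : F₂ ⟶ F₁) (x : F₁) (T₂ : Set F₂) (F' : Scheme.{0}) (β : F' ⟶ F₂) (T' : Set F') : Prop :=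
  ∃ (W : Set F₁) (K₂ : Set F₂) (F₉ : Scheme.{0}) (β₉ : F₉ ⟶ F₂) (T₉ Z₉ K₉ : Set F₉) (b₉ : Bool) (hZ₉ : IsClosed Z₉)
    (F₁₀ : Scheme.{0}) (υ' : F₁₀ ⟶ F₉) (γ' : F' ⟶ F₁₀) (E' : Set F') (Es' : List (Set F')) (K' : Set F'),
    x ∈ W ∧ ¬ (υ ⁻¹' {x} ⊆ closure (υ ⁻¹' (W \ {x}))) ∧
    (∃ U : F₁.affineOpens, x ∈ (U : F₁.Opens) ∧
      ((Scheme.IdealSheafData.vanishingIdeal (⟨closure W, isClosed_closure⟩ : Closeds F₁)).ideal U).IsPrincipal) ∧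
    υ ⁻¹' {x} ∩ closure (υ ⁻¹' (W \ {x})) ⊆ T₂ ∧
    (K₂ = ∅ ∨ (ConeForm F₁ x W ∧ K₂ = closure (υ ⁻¹' (W \ {x})))) ∧
    InCarrierReachK F₂ T₂ (υ ⁻¹' {x} ∩ closure (υ ⁻¹' (W \ {x}))) K₂ F₉ β₉ T₉ Z₉ K₉ b₉ ∧
    Z₉ ⊆ T₉ ∧ ¬ (T₉ ⊆ Z₉) ∧ Z₉.Infinite ∧
    Set.Finite {z : redSub F₉ Z₉ hZ₉ | ¬ IsRegularLocalRing ((redSub F₉ Z₉ hZ₉).presheaf.stalk z)} ∧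
    IsBlowup υ' (Scheme.IdealSheafData.vanishingIdeal (⟨Z₉, hZ₉⟩ : Closeds F₉)) ∧
    (∀ R : (∀ G : Scheme.{0}, (G ⟶ F₁₀) → Set G → Set G → List (Set G) → Set G → Prop),
      R F₁₀ (𝟙 F₁₀) (closure (υ' ⁻¹' (T₉ \ Z₉))) (υ' ⁻¹' Z₉) [] (closure (υ' ⁻¹' (K₉ \ Z₉))) →
      TowerPtRegB F₉ F₁₀ υ' R → TowerPtRamB F₉ F₁₀ υ' R → TowerRoundB F₉ F₁₀ υ' Z₉ hZ₉ R → R F' γ' T' E' Es' K') ∧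
    β = (γ' ≫ υ') ≫ β₉

/-- **ReachNoseTowerB** — `ReachNoseTower₇` with the list component (seed list `[]`). Downstairs only. [OURS · draft] -/
def ReachNoseTowerB (k : Type) [Field k] (n : ℕ) (H : Scheme.{0})
    (ι : H ⟶ (Literature.AlgebraicGeometry.Motives.projectiveSpace n k).left) : Prop :=
  ∃ (Z : Set (Literature.AlgebraicGeometry.Motives.projectiveSpace n k).left) (hZ : IsClosed Z),
    IsLiftableNoseClass₂ k n Z ∧ Z ⊆ Set.range ι ∧ ¬ (Set.range ι ⊆ Z) ∧ Z.Infinite ∧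
    (∀ z : ↥(redSub (Literature.AlgebraicGeometry.Motives.projectiveSpace n k).left Z hZ),
      IsClosed ({z} : Set ↥(redSub (Literature.AlgebraicGeometry.Motives.projectiveSpace n k).left Z hZ)) →
        ringKrullDim ((redSub (Literature.AlgebraicGeometry.Motives.projectiveSpace n k).left Z hZ).presheaf.stalk z) =
          ((1 : ℕ) : WithBot ℕ∞)) ∧
    ∃ (F₂ : Scheme.{0}) (υ : F₂ ⟶ (Literature.AlgebraicGeometry.Motives.projectiveSpace n k).left),
      IsBlowup υ (Scheme.IdealSheafData.vanishingIdeal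
        (⟨Z, hZ⟩ : Closeds (Literature.AlgebraicGeometry.Motives.projectiveSpace n k).left)) ∧
      ∃ (F' : Scheme.{0}) (γ' : F' ⟶ F₂) (T' E' : Set F') (Es' : List (Set F')) (K' : Set F'),
        (∀ R : (∀ G : Scheme.{0}, (G ⟶ F₂) → Set G → Set G → List (Set G) → Set G → Prop),
          R F₂ (𝟙 F₂) (closure (υ ⁻¹' (Set.range ι \ Z))) (υ ⁻¹' Z) [] ∅ →
          TowerPtRegB (Literature.AlgebraicGeometry.Motives.projectiveSpace n k).left F₂ υ R →
          TowerPtRamB (Literature.AlgebraicGeometry.Motives.projectiveSpace n k).left F₂ υ R →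
          TowerRoundB (Literature.AlgebraicGeometry.Motives.projectiveSpace n k).left F₂ υ Z hZ R →
          R F' γ' T' E' Es' K') ∧
        Literature.AlgebraicGeometry.Resolution.Scheme.IsRegular (redSub F' (closure T') isClosed_closure)

/-- **TOWER₆ ⊆ TOWER-B** (forgetful: a ₆-chain is a B-chain retaining NO older surface, `Es = []` throughout). [OURS · pure logic] -/
theorem reachTowerB_of_reachTower₆ (F₁ F₂ : Scheme.{0}) (υ : F₂ ⟶ F₁) (x : F₁) (T₂ : Set F₂) (F' : Scheme.{0}) (β : F' ⟶ F₂)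
    (T' : Set F') (h : ReachTower₆ F₁ F₂ υ x T₂ F' β T') : ReachTowerB F₁ F₂ υ x T₂ F' β T' := by
  obtain ⟨W, K₂, F₉, β₉, T₉, Z₉, K₉, b₉, hZ₉, F₁₀, υ', γ', E', K', h1, h2, h3, h4, h5, h6, h7, h8, h9, h10, h11, hcl, hβ⟩ := h
  refine ⟨W, K₂, F₉, β₉, T₉, Z₉, K₉, b₉, hZ₉, F₁₀, υ', γ', E', [], K', h1, h2, h3, h4, h5, h6, h7, h8, h9, h10, h11, ?_, hβ⟩
  intro R hseed hreg hram hround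
  refine hcl (fun G γ T E K => R G γ T E [] K) hseed ?_ ?_ ?_
  · intro G G' γ T E K y υ₂ hy K'' E'' hR hy1 hy2 hbl hK hE
    exact hreg G G' γ T E [] K y υ₂ hy K'' E'' [] hR hy1 hy2 hbl hK hE (fun F' hF' => by simp at hF')
  · intro G G' γ T E K y J υ₂ K'' E'' hR hy1 hy2 hJ hℓ hbl hK hE
    exact hram G G' γ T E [] K y J υ₂ K'' E'' [] hR hy1 hy2 hJ hℓ hbl hK hE (fun F' hF' => by simp at hF')
  · intro G G' γ T E K hE Z hZ υ₂ K'' hR hZET hne hfull hadm hbl hK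
    exact ⟨hround G G' γ T E [] K hE Z hZ E υ₂ K'' (υ₂ ⁻¹' Z) [] hR (hZET.trans Set.inter_subset_right) hne hfull
        (Or.inl ⟨rfl, hZET.trans Set.inter_subset_left, hadm, Or.inl rfl, hK⟩) hbl (fun F' hF' => by simp at hF'),
      hround G G' γ T E [] K hE Z hZ E υ₂ K'' (closure (υ₂ ⁻¹' (E \ Z))) [] hR (hZET.trans Set.inter_subset_right) hne hfull
        (Or.inl ⟨rfl, hZET.trans Set.inter_subset_left, hadm, Or.inr rfl, hK⟩) hbl (fun F' hF' => by simp at hF')⟩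

/-- **NOSE₇ ⊆ NOSE-B** (forgetful, `Es = []` throughout). [OURS · pure logic] -/
theorem reachNoseTowerB_of_reachNoseTower₇ (k : Type) [Field k] (n : ℕ) (H : Scheme.{0})
    (ι : H ⟶ (Literature.AlgebraicGeometry.Motives.projectiveSpace n k).left) (h : ReachNoseTower₇ k n H ι) :
    ReachNoseTowerB k n H ι := by
  obtain ⟨Z, hZ, h1, h2, h3, h4, h5, F₂, υ, hυ, F', γ', T', E', K', hcl, hreg⟩ := h
  refine ⟨Z, hZ, h1, h2, h3, h4, h5, F₂, υ, hυ, F', γ', T', E', [], K', ?_, hreg⟩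
  intro R hseed hreg' hram hround
  refine hcl (fun G γ T E K => R G γ T E [] K) hseed ?_ ?_ ?_
  · intro G G' γ T E K y υ₂ hy K'' E'' hR hy1 hy2 hbl hK hE
    exact hreg' G G' γ T E [] K y υ₂ hy K'' E'' [] hR hy1 hy2 hbl hK hE (fun F' hF' => by simp at hF')
  · intro G G' γ T E K y J υ₂ K'' E'' hR hy1 hy2 hJ hℓ hbl hK hE
    exact hram G G' γ T E [] K y J υ₂ K'' E'' [] hR hy1 hy2 hJ hℓ hbl hK hE (fun F' hF' => by simp at hF')
  · intro G G' γ T E K hE Z' hZ' υ₂ K'' hR hZET hne hfull hadm hbl hK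
    exact ⟨hround G G' γ T E [] K hE Z' hZ' E υ₂ K'' (υ₂ ⁻¹' Z') [] hR (hZET.trans Set.inter_subset_right) hne hfull
        (Or.inl ⟨rfl, hZET.trans Set.inter_subset_left, hadm, Or.inl rfl, hK⟩) hbl (fun F' hF' => by simp at hF'),
      hround G G' γ T E [] K hE Z' hZ' E υ₂ K'' (closure (υ₂ ⁻¹' (E \ Z'))) [] hR (hZET.trans Set.inter_subset_right) hne hfull
        (Or.inl ⟨rfl, hZET.trans Set.inter_subset_left, hadm, Or.inr rfl, hK⟩) hbl (fun F' hF' => by simp at hF')⟩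

end Summit.ResolutionOfSingularities.ResolutionOfSingularities.Cruxes.EquisingularLiftNat.Sections

end
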